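import Summits.QuantumFields.YangMills.Theorems.AtomicSynthesisRiemannDeriv

/-!
# AtomicSynthesis (stmt-QuantumFields-28126), stub `stub_singleSlot`, step H4b — scaled kernels and the mesh index set

Prover w4 g22 (free hands), toward H4b `RiemannDisc` of planner ym-idea-11 g14's split of `stub_singleSlot`.  Bookkeeping for
the final assembly (`AtomicSynthesisRiemannDisc`): (i) the scaled kernel `Φ_τ(v) = τ⁻⁴ K(τ⁻¹ v)` of a smooth kernel `K` supported
in `B̄(0, R)` is smooth, supported in `B̄(0, τR)`, with `‖D^j Φ_τ‖ ≤ τ⁻⁴ τ^{-j} sup‖D^j K‖`; (ii) a `C^1` function with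
`‖D⁰f‖ ≤ A`, `‖D¹f‖ ≤ A/σ` is bounded by `A` and `A/σ`-Lipschitz; (iii) the finite mesh index set `meshSet c ϱ h` of lattice
points `k` with `‖hk − c‖ ≤ ϱ`: membership and the cardinality bound `#meshSet ≤ (2ϱ/h + 5)⁴`.
No stub/crux/rung/summit is closed by this file; nothing here touches Yang–Mills; the YM mass gap is NOT proved. [folklore]
-/

set_option autoImplicit false

noncomputable section

open MeasureTheory Set Metric
open scoped ContDiff
open Literature.MathematicalPhysics.QuantumLattice (siteToE siteToE_apply)
open Summit.QuantumFields.YangMills.Theorems.OSLegsFromFemtoAndGap.StubLower (abs_apply_le_norm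
  norm_le_two_mul_of_forall_abs_le)
open Summit.QuantumFields.YangMills.Cruxes.AtomicSynthesis.RiemannFloor (smul_siteToE_apply)

namespace Summit.QuantumFields.YangMills.Cruxes.AtomicSynthesis.RiemannDiscKernel

/-! ## Compact supports inside balls -/

/-- A compactly supported function is supported in some closed ball of non-negative radius around the origin. -/
theorem exists_tsupport_subset_closedBall {X : Type*} [Zero X] [TopologicalSpace X] (g : EuclideanSpace ℝ (Fin 4) → X)
    (hg : HasCompactSupport g) : ∃ R : ℝ, 0 ≤ R ∧ tsupport g ⊆ closedBall 0 R := by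
  obtain ⟨R, hR⟩ := hg.isCompact.isBounded.subset_closedBall 0
  exact ⟨max R 0, le_max_right _ _, hR.trans (closedBall_subset_closedBall (le_max_left _ _))⟩

/-! ## The scaled kernel -/

/-- The scaled kernel is smooth. -/
theorem contDiff_scaled (K : EuclideanSpace ℝ (Fin 4) → ℝ) (hK : ContDiff ℝ ∞ K) (τ : ℝ) :
    ContDiff ℝ ∞ (fun v : EuclideanSpace ℝ (Fin 4) => (τ ^ 4)⁻¹ * K (τ⁻¹ • v)) :=
  contDiff_const.mul (hK.comp (contDiff_const_smul τ⁻¹))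

/-- The scaled kernel is supported in the scaled ball. -/
theorem tsupport_scaled_subset (K : EuclideanSpace ℝ (Fin 4) → ℝ) {R : ℝ} (hR : tsupport K ⊆ closedBall 0 R) {τ : ℝ}
    (hτ : 0 < τ) : tsupport (fun v : EuclideanSpace ℝ (Fin 4) => (τ ^ 4)⁻¹ * K (τ⁻¹ • v)) ⊆ closedBall 0 (τ * R) := by
  refine closure_minimal (fun v hv => ?_) isClosed_closedBall
  have h1 : K (τ⁻¹ • v) ≠ 0 := fun h0 => hv (by simp [h0])
  have h2 := hR (subset_tsupport _ (Function.mem_support.mpr h1))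
  rw [mem_closedBall, dist_zero_right, norm_smul, Real.norm_eq_abs, abs_of_pos (inv_pos.2 hτ)] at h2
  rw [mem_closedBall, dist_zero_right]
  rwa [inv_mul_le_iff₀ hτ] at h2

/-- Derivative bounds of the scaled kernel: `‖D^j Φ_τ(y)‖ ≤ τ⁻⁴ (τ⁻¹)^j D_j`. [folklore] -/
theorem norm_iteratedFDeriv_scaled_le (K : EuclideanSpace ℝ (Fin 4) → ℝ) (hK : ContDiff ℝ ∞ K) {τ : ℝ} (hτ : 0 < τ)
    (D : ℕ → ℝ) (hD : ∀ j y, ‖iteratedFDeriv ℝ j K y‖ ≤ D j) (j : ℕ) (y : EuclideanSpace ℝ (Fin 4)) :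
    ‖iteratedFDeriv ℝ j (fun v : EuclideanSpace ℝ (Fin 4) => (τ ^ 4)⁻¹ * K (τ⁻¹ • v)) y‖ ≤ (τ ^ 4)⁻¹ * (τ⁻¹) ^ j * D j := by
  set L : EuclideanSpace ℝ (Fin 4) →L[ℝ] EuclideanSpace ℝ (Fin 4) := τ⁻¹ • ContinuousLinearMap.id ℝ _ with hL
  have hLapp : ∀ v, L v = τ⁻¹ • v := fun v => by simp [hL]
  have hcomp : (fun v : EuclideanSpace ℝ (Fin 4) => K (τ⁻¹ • v)) = K ∘ L := by
    funext v; simp [hLapp]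
  have hKL : ContDiff ℝ ∞ (K ∘ L) := hK.comp L.contDiff
  have e1 : (fun v : EuclideanSpace ℝ (Fin 4) => (τ ^ 4)⁻¹ * K (τ⁻¹ • v)) = fun v => (τ ^ 4)⁻¹ • (K ∘ L) v := by
    funext v; rw [smul_eq_mul, Function.comp_apply, hLapp]
  rw [e1, iteratedFDeriv_const_smul_apply' (hKL.contDiffAt.of_le (by exact_mod_cast le_top)), norm_smul,
    ContinuousLinearMap.iteratedFDeriv_comp_right L hK y (by exact_mod_cast le_top)]
  have hLnorm : ‖L‖ ≤ τ⁻¹ := by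
    rw [hL, norm_smul, Real.norm_eq_abs, abs_of_pos (inv_pos.2 hτ)]
    exact mul_le_of_le_one_right (inv_pos.2 hτ).le ContinuousLinearMap.norm_id_le
  have h1 := ContinuousMultilinearMap.norm_compContinuousLinearMap_le (iteratedFDeriv ℝ j K (L y)) (fun _ => L)
  simp only [Finset.prod_const, Finset.card_univ, Fintype.card_fin] at h1
  rw [Real.norm_eq_abs, abs_of_pos (inv_pos.2 (pow_pos hτ 4)), mul_assoc]
  refine mul_le_mul_of_nonneg_left (h1.trans ?_) (inv_pos.2 (pow_pos hτ 4)).le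
  calc ‖iteratedFDeriv ℝ j K (L y)‖ * ‖L‖ ^ j ≤ D j * (τ⁻¹) ^ j := by
        refine mul_le_mul (hD j _) (pow_le_pow_left₀ (norm_nonneg _) hLnorm j) (by positivity)
          ((norm_nonneg _).trans (hD j (L y)))
    _ = (τ⁻¹) ^ j * D j := mul_comm _ _

/-! ## Sup and Lipschitz bounds from the scale-`σ` derivative bounds -/

/-- `‖D⁰ f‖ ≤ A` gives `|f| ≤ A`. -/
theorem abs_le_of_iteratedFDeriv_zero (f : EuclideanSpace ℝ (Fin 4) → ℝ) {A σ : ℝ} {N : ℕ}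
    (hf : ∀ m : ℕ, m ≤ N → ∀ z, ‖iteratedFDeriv ℝ m f z‖ ≤ A / σ ^ m) (y : EuclideanSpace ℝ (Fin 4)) : |f y| ≤ A := by
  have := hf 0 (Nat.zero_le _) y
  rwa [norm_iteratedFDeriv_zero, Real.norm_eq_abs, pow_zero, div_one] at this

/-- `‖D¹ f‖ ≤ A/σ` gives the Lipschitz bound `|f y − f y'| ≤ (A/σ) ‖y − y'‖` (mean value inequality). -/
theorem lipschitz_of_iteratedFDeriv_one (f : EuclideanSpace ℝ (Fin 4) → ℝ) (hfd : ContDiff ℝ ∞ f) {A σ : ℝ} {N : ℕ}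
    (hN : 1 ≤ N) (hf : ∀ m : ℕ, m ≤ N → ∀ z, ‖iteratedFDeriv ℝ m f z‖ ≤ A / σ ^ m) (y y' : EuclideanSpace ℝ (Fin 4)) :
    |f y - f y'| ≤ A / σ * ‖y - y'‖ := by
  have hd : Differentiable ℝ f := hfd.differentiable (by simp)
  have hbound : ∀ z ∈ (Set.univ : Set (EuclideanSpace ℝ (Fin 4))), ‖fderiv ℝ f z‖ ≤ A / σ := by
    intro z _
    rw [← norm_iteratedFDeriv_zero (𝕜 := ℝ) (f := fderiv ℝ f), norm_iteratedFDeriv_fderiv]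
    have := hf 1 hN z
    rwa [pow_one] at this
  have := convex_univ.norm_image_sub_le_of_norm_fderiv_le (fun z _ => hd.differentiableAt) hbound (mem_univ y') (mem_univ y)
  rwa [Real.norm_eq_abs] at this

/-! ## The mesh index set -/

/-- The finite set of mesh indices `k ∈ ℤ⁴` with `‖h k − c‖ ≤ ϱ` (inside an integer box around `⌊c/h⌋`). -/
def meshSet (c : EuclideanSpace ℝ (Fin 4)) (ϱ h : ℝ) : Finset (Fin 4 → ℤ) :=
  (Fintype.piFinset fun i => Finset.Icc (⌊c i / h⌋ - ((⌈ϱ / h⌉₊ + 1 : ℕ) : ℤ)) (⌊c i / h⌋ + ((⌈ϱ / h⌉₊ + 1 : ℕ) : ℤ))).filter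
    fun k => ‖h • siteToE k - c‖ ≤ ϱ

/-- Members of the mesh set are `ϱ`-close to `c`. -/
theorem norm_sub_le_of_mem_meshSet {c : EuclideanSpace ℝ (Fin 4)} {ϱ h : ℝ} {k : Fin 4 → ℤ} (hk : k ∈ meshSet c ϱ h) :
    ‖h • siteToE k - c‖ ≤ ϱ := (Finset.mem_filter.1 hk).2

/-- **Every mesh point within `ϱ` of `c` is indexed by the mesh set.** -/
theorem mem_meshSet_of_norm_sub_le {c : EuclideanSpace ℝ (Fin 4)} {ϱ h : ℝ} (hh : 0 < h) {k : Fin 4 → ℤ}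
    (hk : ‖h • siteToE k - c‖ ≤ ϱ) : k ∈ meshSet c ϱ h := by
  refine Finset.mem_filter.2 ⟨Fintype.mem_piFinset.2 fun i => Finset.mem_Icc.2 ?_, hk⟩
  have hi : |h * (k i : ℝ) - c i| ≤ ϱ := by
    have := abs_apply_le_norm (h • siteToE k - c) i
    rw [PiLp.sub_apply, smul_siteToE_apply] at this
    exact this.trans hk
  obtain ⟨hi1, hi2⟩ := abs_le.1 hi
  have e1 : (k i : ℝ) ≤ c i / h + ϱ / h := by
    rw [← add_div, le_div_iff₀ hh]; linarith
  have e2 : c i / h - ϱ / h ≤ (k i : ℝ) := by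
    rw [← sub_div, div_le_iff₀ hh]; linarith
  have f1 := Int.floor_le (c i / h)
  have f2 := Int.lt_floor_add_one (c i / h)
  have g1 := Nat.le_ceil (ϱ / h)
  constructor
  · have : ((⌊c i / h⌋ - ((⌈ϱ / h⌉₊ + 1 : ℕ) : ℤ) : ℤ) : ℝ) ≤ (k i : ℝ) := by push_cast; linarith
    exact_mod_cast this
  · have : (k i : ℝ) ≤ ((⌊c i / h⌋ + ((⌈ϱ / h⌉₊ + 1 : ℕ) : ℤ) : ℤ) : ℝ) := by push_cast; linarith
    exact_mod_cast this

/-- **Cardinality of the mesh set**: `#meshSet ≤ (2ϱ/h + 5)⁴` for `h > 0`, `ϱ ≥ 0`. -/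
theorem card_meshSet_le (c : EuclideanSpace ℝ (Fin 4)) {ϱ h : ℝ} (hϱ : 0 ≤ ϱ) (hh : 0 < h) :
    ((meshSet c ϱ h).card : ℝ) ≤ (2 * (ϱ / h) + 5) ^ 4 := by
  set M : ℕ := ⌈ϱ / h⌉₊ + 1 with hM
  have hbox : ((Fintype.piFinset fun i : Fin 4 => Finset.Icc (⌊c i / h⌋ - (M : ℤ)) (⌊c i / h⌋ + (M : ℤ))).card : ℝ) =
      ((2 * M + 1 : ℕ) : ℝ) ^ 4 := by
    rw [Fintype.card_piFinset]
    have : ∀ i : Fin 4, (Finset.Icc (⌊c i / h⌋ - (M : ℤ)) (⌊c i / h⌋ + (M : ℤ))).card = 2 * M + 1 := by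
      intro i
      rw [Int.card_Icc]
      omega
    simp only [this, Finset.prod_const, Finset.card_univ, Fintype.card_fin]
    push_cast
    ring
  have hM' : ((2 * M + 1 : ℕ) : ℝ) ≤ 2 * (ϱ / h) + 5 := by
    have := Nat.ceil_lt_add_one (div_nonneg hϱ hh.le)
    rw [hM]; push_cast; linarith
  calc ((meshSet c ϱ h).card : ℝ)
      ≤ ((Fintype.piFinset fun i : Fin 4 => Finset.Icc (⌊c i / h⌋ - (M : ℤ)) (⌊c i / h⌋ + (M : ℤ))).card : ℝ) := by
        exact_mod_cast Finset.card_filter_le _ _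
    _ = ((2 * M + 1 : ℕ) : ℝ) ^ 4 := hbox
    _ ≤ (2 * (ϱ / h) + 5) ^ 4 := pow_le_pow_left₀ (by positivity) hM' 4

end Summit.QuantumFields.YangMills.Cruxes.AtomicSynthesis.RiemannDiscKernel

end
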